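import Mathlib
import Literature.Geometry.DiscreteGeometry.DelaunaySubdivision
import HarnessLib

/-!
# Crux `SquareWellLayerCake.AveragedTwelve` (stmt-AtomisticToContinuum-15806), line `Sketch`
# (idea par-five-delaunay-recount), stub `stub_nearTriangle` — near triangles are Delaunay

This file is stub `stub_nearTriangle` of line `Sketch` (idea par-five-delaunay-recount) of crux
`SquareWellLayerCake.AveragedTwelve` (stmt-AtomisticToContinuum-15806).

**Statement.** Let `ω ⊆ ℝ³` be `d`-separated (`0 < d`) and let `K` be a Delaunay triangulation
of `ω` (`Literature.Geometry.DiscreteGeometry.IsDelaunayTriangulation`: vertices `= ω`, domain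
`conv ω`, every simplex has an empty circumscribed sphere). If `a, b, c ∈ ω` are three distinct
sites with pairwise distances `≤ (57/50) d` (a *near triangle*), then `{a, b, c}` is a simplex of
`K` — the two-dimensional analogue of
`Literature.Geometry.DiscreteGeometry.IsDelaunayTriangulation.pair_mem_of_gabriel`.

**Proof (four applications of Huygens' barycentre identity
`Literature.Geometry.DiscreteGeometry.sum_mul_dist_sq`:
`∑ w_p |p − x|² = |m − x|² + ∑ w_p |p − m|²` for `m = ∑ w_p p`, `∑ w_p = 1`).**
Let `m = (a + b + c)/3` be the centroid. It lies in `conv ω = |K|`, hence in the closed simplex of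
some `T ∈ K`: `m = ∑_{y ∈ T} w_y y` with `w ≥ 0`, `∑ w = 1`; let `(c', r)` be an empty
circumsphere of `T`.  Huygens for `(T, w)` at `c'` reads `r² = |m − c'|² + ∑_T w_y |y − m|²`;
Huygens for the uniform weights on `{a, b, c}` at `c'`, where each `|s − c'| ≥ r` (no site inside
the sphere), gives `r² ≤ |m − c'|² + (1/3) ∑_s |s − m|²`; hence
`∑_T w_y |y − m|² ≤ (1/3) ∑_s |s − m|²`.  If, say, `a ∉ T`, then every vertex `y` of `T` is a
site `≠ a`, so `|y − a| ≥ d`, and Huygens for `(T, w)` at `a` gives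
`d² ≤ |m − a|² + ∑_T w_y |y − m|² ≤ |m − a|² + (1/3) ∑_s |s − m|²`, which by Huygens for
`{a, b, c}` at `a` equals `(1/3)(|ab|² + |ac|²) ≤ (2/3)(57/50)² d² < d²` — a contradiction.  So
`a, b, c ∈ T`, and `{a, b, c} ∈ K` because faces of simplices are simplices.  The engine is the
general criterion `mem_faces_of_sum_mul_dist_sq_lt`: a finite set of sites `S` carrying a
probability vector `μ` with `∑_s μ_s |s − s₀|² < d²` for every `s₀ ∈ S` is a simplex of EVERY
Delaunay triangulation of a `d`-separated set, in any real inner product space (no circumcentre,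
acuteness or affine independence is needed).
-/

noncomputable section

namespace Summit.AtomisticToContinuum.Crystallization.Theorems.ParFiveRecountNearTriangle

open Literature.Geometry.DiscreteGeometry

variable {V : Type*} [NormedAddCommGroup V] [InnerProductSpace ℝ V]

/-- **Huygens engine.** In a `d`-separated set of sites `ω`, let the point `m` be a convex
combination `∑_{s ∈ S} μ_s s` of sites and also a convex combination `∑_{y ∈ T} w_y y` of a finite
set of sites `T` having an empty circumsphere.  If a site `s₀` has `μ`-second moment
`∑_s μ_s |s − s₀|² < d²`, then `s₀ ∈ T`: otherwise every point of `T` is at distance `≥ d` from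
`s₀`, while comparing Huygens' identity for `(T, w)` and for `(S, μ)` at the centre of the empty
sphere and at `s₀` gives `∑_T w_y |y − s₀|² ≤ ∑_S μ_s |s − s₀|² < d²`. [folklore] -/
theorem mem_of_sum_mul_dist_sq_lt {ω : Set V} {d : ℝ} (hd : 0 < d)
    (hsep : ∀ x ∈ ω, ∀ y ∈ ω, x ≠ y → d ≤ dist x y) {S : Finset V} {μ : V → ℝ}
    (hμ0 : ∀ s ∈ S, 0 ≤ μ s) (hμ1 : ∑ s ∈ S, μ s = 1) (hSω : ∀ s ∈ S, s ∈ ω) {T : Finset V}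
    (hTω : ∀ y ∈ T, y ∈ ω) (hE : HasEmptyCircumsphere ω (T : Set V)) {w : V → ℝ}
    (hw0 : ∀ y ∈ T, 0 ≤ w y) (hw1 : ∑ y ∈ T, w y = 1) {m : V} (hmT : ∑ y ∈ T, w y • y = m)
    (hmS : ∑ s ∈ S, μ s • s = m) {s₀ : V} (hs₀ : s₀ ∈ ω)
    (hlt : ∑ s ∈ S, μ s * dist s s₀ ^ 2 < d ^ 2) : s₀ ∈ T := by
  by_contra h
  obtain ⟨c', r, hs, hω'⟩ := hE
  obtain ⟨y₀, hy₀⟩ := Finset.nonempty_of_sum_ne_zero (by rw [hw1]; exact one_ne_zero)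
  have hr0 : 0 ≤ r := (hs y₀ (Finset.mem_coe.2 hy₀)) ▸ dist_nonneg
  -- Huygens for `(T, w)` at `c'`: the left side is `r²`
  have hH1 := sum_mul_dist_sq T hw1 c'
  have hL1 : ∑ y ∈ T, w y * dist y c' ^ 2 = r ^ 2 := by
    rw [Finset.sum_congr rfl fun y hy => by rw [hs y (Finset.mem_coe.2 hy)], ← Finset.sum_mul,
      hw1, one_mul]
  -- Huygens for `(S, μ)` at `c'`: the left side is `≥ r²` (no site inside the sphere)
  have hH2 := sum_mul_dist_sq S hμ1 c'
  have hL2 : r ^ 2 ≤ ∑ s ∈ S, μ s * dist s c' ^ 2 :=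
    calc r ^ 2 = ∑ s ∈ S, μ s * r ^ 2 := by rw [← Finset.sum_mul, hμ1, one_mul]
      _ ≤ ∑ s ∈ S, μ s * dist s c' ^ 2 := Finset.sum_le_sum fun s hs' =>
          mul_le_mul_of_nonneg_left (pow_le_pow_left₀ hr0 (hω' s (hSω s hs')) 2) (hμ0 s hs')
  -- Huygens for `(T, w)` at `s₀`: the left side is `≥ d²` (every point of `T` is a site `≠ s₀`)
  have hH3 := sum_mul_dist_sq T hw1 s₀
  have hL3 : d ^ 2 ≤ ∑ y ∈ T, w y * dist y s₀ ^ 2 :=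
    calc d ^ 2 = ∑ y ∈ T, w y * d ^ 2 := by rw [← Finset.sum_mul, hw1, one_mul]
      _ ≤ ∑ y ∈ T, w y * dist y s₀ ^ 2 := Finset.sum_le_sum fun y hy =>
          mul_le_mul_of_nonneg_left (pow_le_pow_left₀ hd.le
            (hsep y (hTω y hy) s₀ hs₀ fun e => h (by rw [← e]; exact hy)) 2) (hw0 y hy)
  -- Huygens for `(S, μ)` at `s₀`
  have hH4 := sum_mul_dist_sq S hμ1 s₀
  rw [hmT] at hH1 hH3
  rw [hmS] at hH2 hH4
  linarith

/-- **Simplex criterion.** In a Delaunay triangulation `K` of a `d`-separated set of sites `ω`, a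
finite non-empty set of sites `S` carrying a probability vector `μ` whose second moment about
EVERY point of `S` is `< d²` (`∑_s μ_s |s − s₀|² < d²` for all `s₀ ∈ S`) is a simplex of `K`: the
barycentre `m = ∑ μ_s s ∈ conv ω = |K|` lies in the closed simplex of some `T ∈ K`, every point
of `S` is a vertex of `T` (`mem_of_sum_mul_dist_sq_lt`), and faces of simplices are simplices.
[folklore] -/
theorem mem_faces_of_sum_mul_dist_sq_lt {ω : Set V} {K : Geometry.SimplicialComplex ℝ V}
    (hK : IsDelaunayTriangulation ω K) {d : ℝ} (hd : 0 < d)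
    (hsep : ∀ x ∈ ω, ∀ y ∈ ω, x ≠ y → d ≤ dist x y) {S : Finset V} (hS : S.Nonempty)
    (hSω : ∀ s ∈ S, s ∈ ω) {μ : V → ℝ} (hμ0 : ∀ s ∈ S, 0 ≤ μ s) (hμ1 : ∑ s ∈ S, μ s = 1)
    (hlt : ∀ s₀ ∈ S, ∑ s ∈ S, μ s * dist s s₀ ^ 2 < d ^ 2) : S ∈ K.faces := by
  have hm : ∑ s ∈ S, μ s • s ∈ K.space := by
    rw [hK.space_eq]
    exact convexHull_mono (fun s hs => hSω s (Finset.mem_coe.1 hs))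
      (Finset.mem_convexHull'.2 ⟨μ, hμ0, hμ1, rfl⟩)
  obtain ⟨T, hT, hmT⟩ := Geometry.SimplicialComplex.mem_space_iff.1 hm
  obtain ⟨w, hw0, hw1, hwm⟩ := Finset.mem_convexHull'.1 hmT
  exact K.down_closed hT (fun s₀ hs₀ => mem_of_sum_mul_dist_sq_lt hd hsep hμ0 hμ1 hSω
    (fun y hy => hK.mem_of_mem hT hy) (hK.empty_sphere hT) hw0 hw1 hwm rfl (hSω s₀ hs₀)
    (hlt s₀ hs₀)) hS

/-- **Near triangles are Delaunay** (stub `stub_nearTriangle`). In a Delaunay triangulation of a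
`d`-separated set `ω ⊆ ℝ³`, three distinct sites with pairwise distances `≤ (57/50) d` span a
simplex: apply the simplex criterion `mem_faces_of_sum_mul_dist_sq_lt` to `S = {a, b, c}` with the
uniform weights `1/3`, the second moment about `a` being `(|ab|² + |ac|²)/3 ≤ (2/3)(57/50)² d² < d²`
(and likewise about `b` and `c`). [folklore] -/
theorem stub_nearTriangle : ∀ (d : ℝ), 0 < d → ∀ (ω : Set (EuclideanSpace ℝ (Fin 3))) (K : Geometry.SimplicialComplex ℝ (EuclideanSpace ℝ (Fin 3))), Literature.Geometry.DiscreteGeometry.IsDelaunayTriangulation ω K → (∀ x ∈ ω, ∀ y ∈ ω, x ≠ y → d ≤ dist x y) → ∀ (a b c : EuclideanSpace ℝ (Fin 3)), a ∈ ω → b ∈ ω → c ∈ ω → a ≠ b → a ≠ c → b ≠ c → dist a b ≤ 57 / 50 * d → dist a c ≤ 57 / 50 * d → dist b c ≤ 57 / 50 * d → ({a, b, c} : Finset (EuclideanSpace ℝ (Fin 3))) ∈ K.faces := by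
  intro d hd ω K hK hsep a b c ha hb hc hab hac hbc hdab hdac hdbc
  have hbc' : b ∉ ({c} : Finset (EuclideanSpace ℝ (Fin 3))) := by rwa [Finset.mem_singleton]
  have habc : a ∉ ({b, c} : Finset (EuclideanSpace ℝ (Fin 3))) := by
    rw [Finset.mem_insert, Finset.mem_singleton, not_or]
    exact ⟨hab, hac⟩
  have hsum : ∀ f : EuclideanSpace ℝ (Fin 3) → ℝ,
      ∑ s ∈ ({a, b, c} : Finset (EuclideanSpace ℝ (Fin 3))), f s = f a + (f b + f c) := fun f => by
    rw [Finset.sum_insert habc, Finset.sum_insert hbc', Finset.sum_singleton]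
  have hab2 : dist a b ^ 2 ≤ (57 / 50 * d) ^ 2 := pow_le_pow_left₀ dist_nonneg hdab 2
  have hac2 : dist a c ^ 2 ≤ (57 / 50 * d) ^ 2 := pow_le_pow_left₀ dist_nonneg hdac 2
  have hbc2 : dist b c ^ 2 ≤ (57 / 50 * d) ^ 2 := pow_le_pow_left₀ dist_nonneg hdbc 2
  have hd2 : 0 < d ^ 2 := by positivity
  refine mem_faces_of_sum_mul_dist_sq_lt hK hd hsep (Finset.insert_nonempty a {b, c}) ?_
    (μ := fun _ => 1 / 3) (fun _ _ => by norm_num) (by rw [hsum]; norm_num) ?_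
  · intro s hs
    simp only [Finset.mem_insert, Finset.mem_singleton] at hs
    rcases hs with h | h | h <;> rw [h] <;> assumption
  · intro s₀ hs₀
    rw [hsum]
    simp only [Finset.mem_insert, Finset.mem_singleton] at hs₀
    rcases hs₀ with h | h | h <;> rw [h] <;> simp only [dist_self, dist_comm b a, dist_comm c a,
      dist_comm c b] <;> linarith

end Summit.AtomisticToContinuum.Crystallization.Theorems.ParFiveRecountNearTriangle

end
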